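import Mathlib
import Summits.NavierStokesRegularity.NavierStokesRegularity.Theorems.SubOnsagerCeilingForwardTailCeiling.Negative.ForwardTailCeilingFalseOfSideBranchCeilingEscape
import HarnessLib

/-!
# Route SubOnsagerCeiling — FIXED-FRACTION ESCAPE suffices: no rate is needed to refute the aside cruxes
# (helper file for item stmt-NavierStokesRegularity-25507 `OrthantTailCeiling`; `--supports`; def-free)

The negative lemmas of record for the side-branch dead-end table `α_SB = sideBranchTable`
(`OrthantTailCeiling_false_of_SideBranchCeilingEscape`, p824789; `ForwardTailCeiling_false_of_SideBranchCeilingEscape`,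
p824871) are modulo `SideBranchCeilingEscapeAt ε₀`: for every candidate ceiling `(θ, C)` ONE block `0..K`
must lose MORE than the ceiling's own tail `C·E₀·(1+ε₀)^{-2θ(K+1)}` by a viscosity-uniform time.  The
lineage's construction target of record (`SideBranchShellRetentionAt ε₀ g η₀`, p825614) asks for PER-SHELL
retention at the Onsager-critical rate `g ≤ 1 − 1/(1+ε₀)` at every shell `1..K`.  This file records that
NO RATE WHATSOEVER is needed: because `(1+ε₀)^{-2θ(K+1)} → 0` as `K → ∞`, it is enough that SOME FIXED
FRACTION `q > 0` of the datum energy — however small, independent of the depth — leaves every finite block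
`0..K` by a depth-dependent, viscosity-uniform time, along the non-negative ceiling-obeying regular solutions
(the ceiling may be USED while proving it, exactly as in p824789):

* `sideBranchCeilingEscapeAt_of_fractionEscape` — hypothesis inline (fraction escape with `q > 0`,
  horizon `T = T(K)`, threshold `ν₀ = ν₀(K)`, ceiling and non-negativity available) `→ SideBranchCeilingEscapeAt ε₀`;
* `orthantTailCeiling_false_of_fractionEscape`, `forwardTailCeiling_false_of_fractionEscape` — the two
  aside cruxes BY NAME modulo fraction escape at some `ε₀ ∈ (0,1]`.

So the whole remaining debt of the two conditional refutations is the qualitative-with-a-constant statement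
«ANOMALOUS ESCAPE SURVIVES THE SIDE DRAIN»: a fixed part of the energy of `α_SB` is neither parked in the
first `K` dead-end pockets nor lingering in the first `K` chain/side modes at a late, `ν`-uniform time.  For
the bare Katz–Pavlović chain (no side branch) this is the anomalous dissipation `E(t) → 0` of all positive
finite-energy solutions (Barbato–Flandoli–Morandin 2011); numerically `q ≈ 0.1` for `α_SB`
(`Cruxes/OrthantTailCeiling/REFUTATION-EVIDENCE.md` §5: `88–90 %` parked).  NOT proved here.

WHY ONLY A FIXED FRACTION IS NEEDED (and why nothing less can work): every bound derivable from the assumed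
`(θ, C)` ceiling alone scales with `C ≥ 1` (forced by `t = 0`), so it can never show that the first
`O(log C)` pockets hold less than `E₀`; some true dynamical input at the shallow shells is necessary, and a
depth-independent escaped fraction is the weakest such input that beats `C·b^{-2θ(K+1)}` at large depth.

HONEST FRAMING: MODEL lattice ODEs only (Tao 2016 §4 vocabulary; rung TL-M2Break); a reduction between
unproved statements plus bookkeeping; settles nothing by itself; nothing here is a statement about the
Navier–Stokes equations. [cite: Tao2016AveragedNS, §4 (4.5), the viscous equation before Thm. 4.2];
Katz–Pavlović couplings: [cite: BarbatoMorandinRomito2011, §2].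
-/

noncomputable section

-- the sub-problem namespace `NavierStokesRegularity.NavierStokesRegularity` is the tree's layout (D-0017)
set_option linter.dupNamespace false

namespace Summit.NavierStokesRegularity.NavierStokesRegularity.Theorems.SubOnsagerCeiling

open Set Filter
open scoped Topology
open Literature.Analysis.FluidPDE.TaoCascade
open Summit.NavierStokesRegularity.NavierStokesRegularity.Theses.SubOnsagerCeiling

/-- **FIXED-FRACTION ESCAPE `→ SideBranchCeilingEscapeAt ε₀`.**  Hypothesis (inline): there is `q > 0`
such that for every candidate ceiling `(θ, C)` some one-shell datum `X₀` of positive energy `E₀` has, for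
EVERY depth `K`, a horizon `T > 0` and a threshold `ν₀ > 0` such that for every `0 < ν ≤ ν₀` some
`s ∈ (0, T]` makes every regular `ν`-viscous solution of `α_SB` on `[0, s]` from `X₀` (one-shell datum, no
shells below `0`, Tao's weight bound (4.5), continuous modes, exact equation within `[0,s]`) that is
non-negative on the shells `≥ 1` and obeys the `(θ, C)` tail ceiling on `[0, s]` satisfy
`Σ_{k ≤ K} Σ_i ½X_{i,k}(s)² ≤ (1 − q)·E₀`.  Conclusion: `SideBranchCeilingEscapeAt ε₀` — take the depth `K`
with `C·(1+ε₀)^{-2θ(K+1)} < q` and the escape amount `w = q·E₀`.  MODEL lattice only; a reduction between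
unproved statements. [this file] -/
theorem sideBranchCeilingEscapeAt_of_fractionEscape {ε₀ q : ℝ} (hε : 0 < ε₀) (hq : 0 < q)
    (h : ∀ θ : ℝ, 1 / 2 < θ → ∀ C : ℝ, 0 ≤ C →
      ∃ X₀ : Fin 4 → ℝ, 0 < (∑ i : Fin 4, (1 / 2 : ℝ) * X₀ i ^ 2) ∧
      ∀ K : ℕ, ∃ T : ℝ, 0 < T ∧ ∃ ν₀ : ℝ, 0 < ν₀ ∧
      ∀ ν : ℝ, 0 < ν → ν ≤ ν₀ → ∃ s : ℝ, 0 < s ∧ s ≤ T ∧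
      ∀ X : Fin 4 → ℤ → ℝ → ℝ,
      (∀ (i : Fin 4) (k : ℤ), X i k 0 = if k = 0 then X₀ i else 0) →
      (∀ (i : Fin 4) (k : ℤ), k < 0 → ∀ t : ℝ, X i k t = 0) →
      (∃ M : ℝ, ∀ (t : ℝ) (i : Fin 4) (k : ℤ), (1 + (1 + ε₀) ^ ((10 : ℝ) * k)) * |X i k t| ≤ M) →
      (∀ (i : Fin 4) (k : ℤ), Continuous (X i k)) →
      (∀ (i : Fin 4) (k : ℤ), ∀ t ∈ Set.Icc (0 : ℝ) s, HasDerivWithinAt (X i k)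
      (quadTerm ε₀ sideBranchTable X i k t - ν * (1 + ε₀) ^ ((2 : ℝ) * k) * X i k t)
      (Set.Icc (0 : ℝ) s) t) →
      (∀ t ∈ Set.Icc (0 : ℝ) s, ∀ (i : Fin 4) (k : ℤ), 1 ≤ k → 0 ≤ X i k t) →
      (∀ n N : ℕ, n ≤ N → ∀ u ∈ Set.Icc (0 : ℝ) s,
      ∑ k ∈ Finset.Icc n N, ∑ i : Fin 4, (1 / 2 : ℝ) * X i (k : ℤ) u ^ 2 ≤
      C * (∑ i : Fin 4, (1 / 2 : ℝ) * X₀ i ^ 2) * (1 + ε₀) ^ (-(2 * θ * (n : ℝ)))) →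
      (∑ k ∈ Finset.range (K + 1), ∑ i : Fin 4, (1 / 2 : ℝ) * X i (k : ℤ) s ^ 2) ≤
      (1 - q) * (∑ i : Fin 4, (1 / 2 : ℝ) * X₀ i ^ 2)) :
    SideBranchCeilingEscapeAt ε₀ := by
  intro θ hθ C hC
  have hb : (0 : ℝ) < 1 + ε₀ := by linarith
  have hb1 : (1 : ℝ) < 1 + ε₀ := by linarith
  obtain ⟨X₀, hE₀, hK⟩ := h θ hθ C hC
  set E₀ : ℝ := ∑ i : Fin 4, (1 / 2 : ℝ) * X₀ i ^ 2 with hE₀def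
  -- depth: `C · r^(K+1) < q`, `r = b^{-2θ} < 1`
  set r : ℝ := (1 + ε₀) ^ (-(2 * θ)) with hrdef
  have hr0 : 0 ≤ r := Real.rpow_nonneg hb.le _
  have hr1 : r < 1 := Real.rpow_lt_one_of_one_lt_of_neg hb1 (by linarith)
  have htend : Tendsto (fun K : ℕ => C * r ^ (K + 1)) atTop (𝓝 (C * 0)) :=
    ((tendsto_pow_atTop_nhds_zero_of_lt_one hr0 hr1).comp (tendsto_add_atTop_nat 1)).const_mul C
  rw [mul_zero] at htend
  obtain ⟨K, hKlt⟩ := (htend.eventually (gt_mem_nhds hq)).exists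
  obtain ⟨T, hT, ν₀, hν₀, hν⟩ := hK K
  refine ⟨K, X₀, hE₀, T, hT, ν₀, hν₀, q * E₀, ?_, fun ν hνpos hνle => ?_⟩
  · -- `C E₀ b^{-2θ(K+1)} = C r^{K+1} E₀ < q E₀`
    have hpow : (1 + ε₀) ^ (-(2 * θ * ((K + 1 : ℕ) : ℝ))) = r ^ (K + 1) := by
      rw [hrdef, ← Real.rpow_mul_natCast hb.le]
      congr 1
      push_cast
      ring
    rw [hpow]
    have h1 : C * E₀ * r ^ (K + 1) = (C * r ^ (K + 1)) * E₀ := by ring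
    rw [h1]
    exact mul_lt_mul_of_pos_right hKlt hE₀
  · obtain ⟨s, hs, hsT, hall⟩ := hν ν hνpos hνle
    refine ⟨s, hs, hsT, fun X hinit hlow hbd hcont hder hpos hceil => ?_⟩
    have h1 := hall X hinit hlow hbd hcont hder hpos hceil
    have h2 : (1 - q) * E₀ = E₀ - q * E₀ := by ring
    rw [h2] at h1
    exact h1

/-- **`OrthantTailCeiling` (stmt-25507) BY NAME modulo fixed-fraction escape at some scale ratio
`ε₀ ∈ (0,1]`** (hypothesis inline, same shape as in `sideBranchCeilingEscapeAt_of_fractionEscape`).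
MODEL lattice only; conditional; settles nothing by itself. [this file] -/
theorem orthantTailCeiling_false_of_fractionEscape
    (h : ∃ ε₀ : ℝ, 0 < ε₀ ∧ ε₀ ≤ 1 ∧ ∃ q : ℝ, 0 < q ∧
      ∀ θ : ℝ, 1 / 2 < θ → ∀ C : ℝ, 0 ≤ C →
      ∃ X₀ : Fin 4 → ℝ, 0 < (∑ i : Fin 4, (1 / 2 : ℝ) * X₀ i ^ 2) ∧
      ∀ K : ℕ, ∃ T : ℝ, 0 < T ∧ ∃ ν₀ : ℝ, 0 < ν₀ ∧
      ∀ ν : ℝ, 0 < ν → ν ≤ ν₀ → ∃ s : ℝ, 0 < s ∧ s ≤ T ∧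
      ∀ X : Fin 4 → ℤ → ℝ → ℝ,
      (∀ (i : Fin 4) (k : ℤ), X i k 0 = if k = 0 then X₀ i else 0) →
      (∀ (i : Fin 4) (k : ℤ), k < 0 → ∀ t : ℝ, X i k t = 0) →
      (∃ M : ℝ, ∀ (t : ℝ) (i : Fin 4) (k : ℤ), (1 + (1 + ε₀) ^ ((10 : ℝ) * k)) * |X i k t| ≤ M) →
      (∀ (i : Fin 4) (k : ℤ), Continuous (X i k)) →
      (∀ (i : Fin 4) (k : ℤ), ∀ t ∈ Set.Icc (0 : ℝ) s, HasDerivWithinAt (X i k)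
      (quadTerm ε₀ sideBranchTable X i k t - ν * (1 + ε₀) ^ ((2 : ℝ) * k) * X i k t)
      (Set.Icc (0 : ℝ) s) t) →
      (∀ t ∈ Set.Icc (0 : ℝ) s, ∀ (i : Fin 4) (k : ℤ), 1 ≤ k → 0 ≤ X i k t) →
      (∀ n N : ℕ, n ≤ N → ∀ u ∈ Set.Icc (0 : ℝ) s,
      ∑ k ∈ Finset.Icc n N, ∑ i : Fin 4, (1 / 2 : ℝ) * X i (k : ℤ) u ^ 2 ≤
      C * (∑ i : Fin 4, (1 / 2 : ℝ) * X₀ i ^ 2) * (1 + ε₀) ^ (-(2 * θ * (n : ℝ)))) →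
      (∑ k ∈ Finset.range (K + 1), ∑ i : Fin 4, (1 / 2 : ℝ) * X i (k : ℤ) s ^ 2) ≤
      (1 - q) * (∑ i : Fin 4, (1 / 2 : ℝ) * X₀ i ^ 2)) :
    ¬ OrthantTailCeiling := by
  obtain ⟨ε₀, hε, hε1, q, hq, hfrac⟩ := h
  exact orthantTailCeiling_false_of_sideBranchCeilingEscape
    ⟨ε₀, hε, hε1, sideBranchCeilingEscapeAt_of_fractionEscape hε hq hfrac⟩

/-- **`ForwardTailCeiling` (stmt-26608) BY NAME modulo fixed-fraction escape at some scale ratio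
`ε₀ ∈ (0,1]`** (twin reduction of record, p824871).  MODEL lattice only; conditional; settles nothing by
itself. [this file] -/
theorem forwardTailCeiling_false_of_fractionEscape
    (h : ∃ ε₀ : ℝ, 0 < ε₀ ∧ ε₀ ≤ 1 ∧ ∃ q : ℝ, 0 < q ∧
      ∀ θ : ℝ, 1 / 2 < θ → ∀ C : ℝ, 0 ≤ C →
      ∃ X₀ : Fin 4 → ℝ, 0 < (∑ i : Fin 4, (1 / 2 : ℝ) * X₀ i ^ 2) ∧
      ∀ K : ℕ, ∃ T : ℝ, 0 < T ∧ ∃ ν₀ : ℝ, 0 < ν₀ ∧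
      ∀ ν : ℝ, 0 < ν → ν ≤ ν₀ → ∃ s : ℝ, 0 < s ∧ s ≤ T ∧
      ∀ X : Fin 4 → ℤ → ℝ → ℝ,
      (∀ (i : Fin 4) (k : ℤ), X i k 0 = if k = 0 then X₀ i else 0) →
      (∀ (i : Fin 4) (k : ℤ), k < 0 → ∀ t : ℝ, X i k t = 0) →
      (∃ M : ℝ, ∀ (t : ℝ) (i : Fin 4) (k : ℤ), (1 + (1 + ε₀) ^ ((10 : ℝ) * k)) * |X i k t| ≤ M) →
      (∀ (i : Fin 4) (k : ℤ), Continuous (X i k)) →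
      (∀ (i : Fin 4) (k : ℤ), ∀ t ∈ Set.Icc (0 : ℝ) s, HasDerivWithinAt (X i k)
      (quadTerm ε₀ sideBranchTable X i k t - ν * (1 + ε₀) ^ ((2 : ℝ) * k) * X i k t)
      (Set.Icc (0 : ℝ) s) t) →
      (∀ t ∈ Set.Icc (0 : ℝ) s, ∀ (i : Fin 4) (k : ℤ), 1 ≤ k → 0 ≤ X i k t) →
      (∀ n N : ℕ, n ≤ N → ∀ u ∈ Set.Icc (0 : ℝ) s,
      ∑ k ∈ Finset.Icc n N, ∑ i : Fin 4, (1 / 2 : ℝ) * X i (k : ℤ) u ^ 2 ≤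
      C * (∑ i : Fin 4, (1 / 2 : ℝ) * X₀ i ^ 2) * (1 + ε₀) ^ (-(2 * θ * (n : ℝ)))) →
      (∑ k ∈ Finset.range (K + 1), ∑ i : Fin 4, (1 / 2 : ℝ) * X i (k : ℤ) s ^ 2) ≤
      (1 - q) * (∑ i : Fin 4, (1 / 2 : ℝ) * X₀ i ^ 2)) :
    ¬ ForwardTailCeiling := by
  obtain ⟨ε₀, hε, hε1, q, hq, hfrac⟩ := h
  exact forwardTailCeiling_false_of_sideBranchCeilingEscape
    ⟨ε₀, hε, hε1, sideBranchCeilingEscapeAt_of_fractionEscape hε hq hfrac⟩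

end Summit.NavierStokesRegularity.NavierStokesRegularity.Theorems.SubOnsagerCeiling

end
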